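import Mathlib.MeasureTheory.Measure.Lebesgue.EqHaar
import Literature.Analysis.FluidPDE.LeiZhang2011
import Literature.Analysis.FluidPDE.CriticalSpacesProofs
import Literature.Analysis.FluidPDE.VorticityCalculus
import HarnessLib

/-!
# Lei–Zhang 2011: the `BMO` stream class is invariant under the Navier–Stokes rescaling

Analysis/FluidPDE **proofs file** (theorems only: no definitions, no named facts, no `sorry`) on
the discharge path of the named fact
`Literature.Analysis.FluidPDE.LeiZhang2011_regularity_bmoStream` (Z. Lei, Q. S. Zhang,
J. Funct. Anal. 261 (2011) 2323–2345 = arXiv:1011.5066, **Theorem 1.4**, proof §4 pp. 12–13).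

The blow-up sequence of the printed proof is `v^{(k)}(x, t) = Q_k⁻¹ v(x_k + x/Q_k, t_k + t/Q_k²)`
((1.6), p. 12), and the stream hypothesis is carried along it by the sentence "both the stream
function and `r v^θ` are scaling invariant. Thus the stream function of `u` is in BMO and
`r u^θ` is also bounded" (p. 12). This file proves the stream half of that sentence for the
hypothesis class `HasBMOStreamFunctionOn` of the fact (differentiable slices, `curl (B t) = v t`
a.e., `‖B t‖_{BMO} ≤ C`):

* `eBMOSeminorm_comp_add_right`, `eBMOSeminormVec_comp_add_right` — **translation invariance of
  the `BMO` seminorm** for a right-invariant measure (each ball oscillation of `f (· + a)` is a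
  ball oscillation of `f`; Grafakos, *Modern Fourier Analysis*, Prop. 3.1.2 (6)), with the
  change-of-variables plumbing `map_add_right_normalize_restrict_ball`,
  `setAverage_ball_comp_add_right`, `setLAverage_ball_comp_add_right`,
  `laverage_oscillation_comp_add_right` (the translation twins of the dilation lemmas of
  `CriticalSpacesProofs`);
* `eBMOSeminormVec_comp_add_smul` — invariance under `x ↦ x₀ + c x`, `c ≠ 0` (with the tree's
  dilation invariance `eBMOSeminormVec_comp_smul`);
* `curl_comp_add_smul` — `curl (B(x₀ + c ·))(x) = c (curl B)(x₀ + c x)`, unconditionally;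
* `quasiMeasurePreserving_add_smul` — a.e. statements transport along `x ↦ x₀ + c x`;
* `HasBMOStreamFunctionOn.rescale` — **the stream class is invariant**: the rescaled field
  `c v(t₀ + c² t, x₀ + c x)` has the stream function `B(t₀ + c² t, x₀ + c x)` (no prefactor) with
  the *same* `BMO` bound, on the rescaled time set. With `c = Q_k⁻¹`, `(t₀, x₀) = (t_k, x_k)` this
  supplies the uniform bound `‖B^{(k)}‖_{BMO} ≤ C` consumed by
  `eq_zero_of_tendstoUniformlyOn_of_bmoStream` (`LeiZhang2011BlowupEndgame`).

## Mathlib / tree search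

Reused: `eBMOSeminormVec_comp_smul` (`CriticalSpacesProofs`), `laverage_oscillation_le_eBMOSeminorm`
(`BMO`), `curl_eq_curlCLM` (`TaoEnstrophyLocalisation`), `HasBMOStreamFunctionOn`
(`LeiZhang2011`); Mathlib `map_add_right_eq_self`, `MeasurableEmbedding.restrict_map`,
`fderiv_comp_smul`, `fderiv_comp_add_left`, `Measure.quasiMeasurePreserving_smul`,
`measurePreserving_add_left`. `lean search 'eBMOSeminorm.*(add|translate)'`: no translation
invariance of the `BMO` seminorm in the tree before this file (only dilations,
`eBMOSeminorm_comp_smul`); `curl_comp_add_const` (`FlatSwirlGauge`) is the pure translation case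
of `curl_comp_add_smul`.

## References

* Z. Lei, Q. S. Zhang, *A Liouville theorem for the axially-symmetric Navier–Stokes equations*,
  J. Funct. Anal. 261 (2011) 2323–2345 = arXiv:1011.5066: Thm. 1.4, proof §4, (1.6) and Case 1
  (p. 12). [LeiZhang2011]
* L. Grafakos, *Modern Fourier Analysis*, 3rd ed. (2014), Prop. 3.1.2 (6). [GrafakosMFA2014]
-/

noncomputable section

open MeasureTheory Set Function Filter Topology TopologicalSpace Metric
open scoped InnerProductSpace RealInnerProductSpace NNReal ENNReal

namespace Literature.Analysis.FluidPDE

open Literature.Analysis.FunctionSpaces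

/-! ### Translation invariance of the `BMO` seminorm -/

section Translation

variable {E : Type*} [NormedAddCommGroup E] [MeasurableSpace E] [BorelSpace E]
  (μ : Measure E) [μ.IsAddRightInvariant]
variable {F : Type*} [NormedAddCommGroup F] [NormedSpace ℝ F]

omit [MeasurableSpace E] [BorelSpace E] in
/-- The translation `y ↦ y + a` pulls the ball `B(x + a, r)` back to `B(x, r)`. [folklore] -/
theorem preimage_add_right_ball (a x : E) (r : ℝ) :
    (fun y : E => y + a) ⁻¹' ball (x + a) r = ball x r := by
  ext y
  simp [mem_ball, dist_eq_norm]

/-- **Normalised ball measures are translation invariant**: the push-forward under `y ↦ y + a`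
of `|B(x,r)|⁻¹ μ|_{B(x,r)}` is `|B(x+a,r)|⁻¹ μ|_{B(x+a,r)}` for a right-invariant `μ`. [folklore] -/
theorem map_add_right_normalize_restrict_ball (a x : E) (r : ℝ) :
    Measure.map (fun y : E => y + a) ((μ (ball x r))⁻¹ • μ.restrict (ball x r)) =
      (μ (ball (x + a) r))⁻¹ • μ.restrict (ball (x + a) r) := by
  have hme : MeasurableEmbedding (fun y : E => y + a) :=
    (Homeomorph.addRight a).measurableEmbedding
  have hvol : μ (ball x r) = μ (ball (x + a) r) := by
    rw [← preimage_add_right_ball a x r,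
      ← Measure.map_apply (measurable_add_const a) measurableSet_ball, map_add_right_eq_self]
  rw [Measure.map_smul, ← preimage_add_right_ball a x r, ← hme.restrict_map μ (ball (x + a) r),
    map_add_right_eq_self, preimage_add_right_ball, hvol]

/-- **Ball averages are translation invariant**: `⨍_{B(x,r)} f(y + a) dμ(y) = ⨍_{B(x+a,r)} f dμ`
(no integrability needed). [folklore] -/
theorem setAverage_ball_comp_add_right (f : E → F) (a x : E) (r : ℝ) :
    ⨍ y in ball x r, f (y + a) ∂μ = ⨍ y in ball (x + a) r, f y ∂μ := by
  have hme : MeasurableEmbedding (fun y : E => y + a) :=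
    (Homeomorph.addRight a).measurableEmbedding
  rw [setAverage_eq', setAverage_eq', ← map_add_right_normalize_restrict_ball μ a x r,
    hme.integral_map]

/-- **Ball averages are translation invariant**, `ℝ≥0∞`-valued form. [folklore] -/
theorem setLAverage_ball_comp_add_right (g : E → ℝ≥0∞) (a x : E) (r : ℝ) :
    ⨍⁻ y in ball x r, g (y + a) ∂μ = ⨍⁻ y in ball (x + a) r, g y ∂μ := by
  have hme : MeasurableEmbedding (fun y : E => y + a) :=
    (Homeomorph.addRight a).measurableEmbedding
  rw [setLAverage_eq', setLAverage_eq', ← map_add_right_normalize_restrict_ball μ a x r,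
    hme.lintegral_map]

/-- The mean oscillation of `f (· + a)` over `B(x, r)` is the mean oscillation of `f` over
`B(x + a, r)`. [folklore] -/
theorem laverage_oscillation_comp_add_right (f : E → F) (a x : E) (r : ℝ) :
    ⨍⁻ y in ball x r, ‖f (y + a) - ⨍ z in ball x r, f (z + a) ∂μ‖ₑ ∂μ =
      ⨍⁻ y in ball (x + a) r, ‖f y - ⨍ z in ball (x + a) r, f z ∂μ‖ₑ ∂μ := by
  rw [setAverage_ball_comp_add_right μ f a x r]
  exact setLAverage_ball_comp_add_right μ (fun y => ‖f y - ⨍ z in ball (x + a) r, f z ∂μ‖ₑ) a x r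

/-- **The `BMO` seminorm is translation invariant**: `‖f (· + a)‖_* = ‖f‖_*` for a
right-invariant measure (Grafakos, *Modern Fourier Analysis*, Prop. 3.1.2 (6), the translation
half). [folklore] -/
theorem eBMOSeminorm_comp_add_right (f : E → F) (a : E) :
    eBMOSeminorm (fun y => f (y + a)) μ = eBMOSeminorm f μ := by
  refine le_antisymm (iSup_le fun x => iSup₂_le fun r hr => ?_)
    (iSup_le fun x => iSup₂_le fun r hr => ?_)
  · rw [laverage_oscillation_comp_add_right μ f a x r]
    exact laverage_oscillation_le_eBMOSeminorm f μ (x + a) hr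
  · have h := laverage_oscillation_comp_add_right μ f a (x - a) r
    rw [sub_add_cancel] at h
    rw [← h]
    exact laverage_oscillation_le_eBMOSeminorm (fun y => f (y + a)) μ (x - a) hr

end Translation

/-- **The vector `BMO` seminorm is translation invariant** (finite-dimensional inner product
space with its Lebesgue measure). [folklore] -/
theorem eBMOSeminormVec_comp_add_right {E : Type*} [NormedAddCommGroup E] [InnerProductSpace ℝ E]
    [FiniteDimensional ℝ E] [MeasurableSpace E] [BorelSpace E] (Φ : E → E) (a : E) :
    eBMOSeminormVec (fun x => Φ (x + a)) = eBMOSeminormVec Φ :=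
  iSup_congr fun v => iSup_congr fun _ => eBMOSeminorm_comp_add_right volume (fun x => ⟪Φ x, v⟫) a

/-- **The vector `BMO` seminorm is invariant under affine rescalings** `x ↦ x₀ + c x`, `c ≠ 0`:
translation (`eBMOSeminormVec_comp_add_right`) and dilation (`eBMOSeminormVec_comp_smul`,
`CriticalSpacesProofs`). [folklore] -/
theorem eBMOSeminormVec_comp_add_smul {E : Type*} [NormedAddCommGroup E] [InnerProductSpace ℝ E]
    [FiniteDimensional ℝ E] [MeasurableSpace E] [BorelSpace E] (Φ : E → E) (x₀ : E) {c : ℝ}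
    (hc : c ≠ 0) : eBMOSeminormVec (fun x => Φ (x₀ + c • x)) = eBMOSeminormVec Φ := by
  have h1 : (fun x => Φ (x₀ + c • x)) = fun x => (fun y => Φ (y + x₀)) (c • x) := by
    funext x; simp [add_comm]
  rw [h1, eBMOSeminormVec_comp_smul (fun y => Φ (y + x₀)) hc, eBMOSeminormVec_comp_add_right]

/-! ### The curl of a rescaled field -/

/-- **Curl of an affinely rescaled field**: `curl (B(x₀ + c ·))(x) = c · (curl B)(x₀ + c x)`, with
no differentiability hypothesis (both sides are junk together; `fderiv_comp_smul`,
`fderiv_comp_add_left`). [folklore] -/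
theorem curl_comp_add_smul (B : EuclideanSpace ℝ (Fin 3) → EuclideanSpace ℝ (Fin 3))
    (x₀ : EuclideanSpace ℝ (Fin 3)) (c : ℝ) (x : EuclideanSpace ℝ (Fin 3)) :
    curl (fun y => B (x₀ + c • y)) x = c • curl B (x₀ + c • x) := by
  rw [curl_eq_curlCLM, curl_eq_curlCLM]
  have h : fderiv ℝ (fun y => B (x₀ + c • y)) x = c • fderiv ℝ B (x₀ + c • x) := by
    have h2 := fderiv_comp_smul (𝕜 := ℝ) (f := fun z => B (x₀ + z)) (x := x) c
    simp only [fderiv_comp_add_left] at h2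
    exact h2
  rw [h, map_smul]

/-! ### The `BMO` stream class under the Navier–Stokes rescaling -/

/-- The affine rescaling `x ↦ x₀ + c x`, `c ≠ 0`, is quasi-measure-preserving for Lebesgue
measure (a.e. statements transport along it). [folklore] -/
theorem quasiMeasurePreserving_add_smul (x₀ : EuclideanSpace ℝ (Fin 3)) {c : ℝ} (hc : c ≠ 0) :
    Measure.QuasiMeasurePreserving (fun x : EuclideanSpace ℝ (Fin 3) => x₀ + c • x) volume volume :=
  ((measurePreserving_add_left volume x₀).quasiMeasurePreserving).comp
    (Measure.quasiMeasurePreserving_smul volume hc)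

/-- **The `BMO` stream class is invariant under the Navier–Stokes rescaling and space–time
translations** ("both the stream function and `r v^θ` are scaling invariant. Thus the stream
function of `u` is in BMO", Lei–Zhang, arXiv:1011.5066 p. 12). If `v` has a stream function
`B` with `BMO` slices bounded by `C` on the time set `S` (`HasBMOStreamFunctionOn`), then the
rescaled field `v^{(λ)}(t, x) = c v(t₀ + c² t, x₀ + c x)` (`c = 1/λ ≠ 0`; the blow-up sequence of
the printed proof is `c = Q_k⁻¹`, `(t₀, x₀) = (t_k, x_k)`) has the stream function
`B(t₀ + c² t, x₀ + c x)` — *without* prefactor — with the same bound `C`, on the rescaled time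
set `{t | t₀ + c² t ∈ S}`. [cite: LeiZhang2011, Thm. 1.4, proof §4, Case 1 (arXiv p. 12)] -/
theorem HasBMOStreamFunctionOn.rescale {S : Set ℝ}
    {v B : ℝ → EuclideanSpace ℝ (Fin 3) → EuclideanSpace ℝ (Fin 3)} {C : ℝ≥0}
    (h : HasBMOStreamFunctionOn S v B C) (t₀ : ℝ) (x₀ : EuclideanSpace ℝ (Fin 3)) {c : ℝ}
    (hc : c ≠ 0) :
    HasBMOStreamFunctionOn {t | t₀ + c ^ 2 * t ∈ S}
      (fun t x => c • v (t₀ + c ^ 2 * t) (x₀ + c • x))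
      (fun t x => B (t₀ + c ^ 2 * t) (x₀ + c • x)) C := by
  intro t ht
  obtain ⟨hd, hcurl, hbmo⟩ := h (t₀ + c ^ 2 * t) ht
  refine ⟨?_, ?_, ?_⟩
  · exact hd.comp ((differentiable_const x₀).add (differentiable_id.const_smul c))
  · have hT := (quasiMeasurePreserving_add_smul x₀ hc).ae_eq hcurl
    filter_upwards [hT] with x hx
    simp only [Function.comp_apply] at hx
    rw [curl_comp_add_smul, hx]
  · rw [eBMOSeminormVec_comp_add_smul _ x₀ hc]
    exact hbmo

end Literature.Analysis.FluidPDE
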